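/-
Copyright (c) 2026 the pub-hodgecm-mathlib formalisation cell (harness21).  Prover seat hodgecm-mathlib-K2-defs1 (g4), Track B ∕ K2-LIT,
h413 = `stmt-HodgeConjecture-24833`, line `K2_E1_TraceFormulaBeta`, page «EIS-RANK-ONE», deal (D2-e)-A of the dealer K2E1-plan (g4) 2026-09-04T06:36:29Z
(spec of record: K2E4-p11 (g3) 06:31:35Z ∕ 06:34:34Z, RULING «SHELL-BINDER» 06:31:53Z): FILE 1∕2 — the two Fourier-side decay binders `hdecE`, `hdecF` of the rank-3
cusp bound, generic over the quadratic pair `(F, E, c)`.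
-/
import Summits.HodgeConjecture.HodgeConjecture.Theorems.K2E1EisensteinMinusConstantTermPoissonInputsU3   -- ★ p857966 (K2E4-p11 (g3)): `exists_forall_tsum_indicator_norm_mul_le_linear`; brings ★ CuspBoundU3, ★ FILE A∕B, ★ (E2) decay
import Summits.HodgeConjecture.HodgeConjecture.Theorems.K2E1FlatSectionLineRestrictionArchU3            -- ★ p857895∕p857905 PART II (K2E4-p11 (g3)): the tube lemma `exists_levelIdeal_forall_adelicVal_conj_heisChart_mem_three`
import Summits.HodgeConjecture.HodgeConjecture.Theorems.K2E1AdelicFourierEnvelope                      -- ★ p857712 (F1): `exists_envelope`, `integrable_iff_integrable_prod`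
import HarnessLib

/-!
# h413 ∕ Track B «K2-LIT», «EIS-RANK-ONE» (D2-e)-A FILE 1 — `K2E1EisensteinMinusConstantTermDecayInputsU3`:
# the Fourier-side decay binders `hdecE` (E-layer, centre averages) and `hdecF` (F-layer, centre lines summed over the `x₀`-shell) of
# ★ `forall_norm_sub_borelConstantTerm_le_three`, from the fibrewise archimedean (iii″) triples and the shell-sum binder `hshell`

Cell `pub/hodgecm-mathlib`, crux H413 = `stmt-HodgeConjecture-24833`, route `HCCMUnconditional`; dealer K2E1-plan (g4), deal (D2-e)-A 06:36:29Z; spec of record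
K2E4-p11 (g3) 06:31:35Z ∕ 06:34:34Z + RULING «SHELL-BINDER» 06:31:53Z.  THEOREMS ONLY (no `def`, no `instance`, no `notation`, no named-fact hypothesis, no `sorry`);
lane `--kind proof --supports stmt-HodgeConjecture-24833 --as helper` (count-neutral).  Generic over a quadratic extension `E ∕ F` of number fields with involution
`c`, `c δ = -δ ≠ 0`; FILE 2 `K2E1EisensteinMinusConstantTermBoundedCMThree` specialises to the CM pair `(L⁺, L, complexConj)` and assembles the head.

THE TWO BINDERS (★ p857799 `K2E1EisensteinMinusConstantTermCuspBoundU3.forall_norm_sub_borelConstantTerm_le_three`, letters `hdecE`, `hdecF`, TOKEN FOR TOKEN up to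
the names of the exponents `βE := m ∕ [E:ℚ]`, `βF := m ∕ [F:ℚ]`):
* **`exists_fourierDecay_centreAverage_three`** (`hdecE`) — for the centre averages `Φ^Z_k(V) = μ_F(D_F)⁻¹ ∫ f(ι(w₀)·u(V, θ s)·k) dμ_F(s)` (`k` in a compact `K`, `f`
  right-invariant under a finite level `U₀`): ONE level ideal `𝔪` of `E` for all of `K` (★ PART II tube lemma `exists_levelIdeal_forall_adelicVal_conj_heisChart_mem_three`
  + ★ FILE B `integral_weylLongU_mul_heisChart_add_eq` ⟹ `Φ^Z_k` is `𝔪`-periodic in the finite coordinate), integrability on `𝔸_E` (★ FILE B `integrable_centreAverage_three`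
  + ★ `integrable_iff_integrable_prod`), the E-layer (iii″) triple (`AE`, `N₂E`, `hdecArchE`) ⟹ ★ (F1) `exists_envelope` over `E` ⟹ ★ (E2)
  `exists_forall_tsum_indicator_norm_mul_le_rpow_neg` over `E` at `t = l₁⁻¹`: `Σ'_{ξ ≠ 0} ‖𝓕_E Φ^Z_k(ξ l₁⁻¹)‖ ≤ C_E · (‖l₁‖⁻¹)^(−m∕[E:ℚ])`.
* **`exists_fourierDecay_centreLine_shell_three`** (`hdecF`) — for the centre lines `Φ_{k,X}(v) = f(ι(w₀)·u(X, θ v)·k)` at the shell centres `X = l₁·(x₀ − Y)`,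
  `x₀ ∈ E`: ONE level ideal `𝔫` of `F` (same tube lemma + ★ FILE A `apply_weylLongU_mul_heisChart_add_eq`), integrability (★ FILE A `integrable_centreLine_three`), the
  F-layer (iii″) triple (`AF`, `N₂F`, `hdecArchF`, per centre `X`) ⟹ ★ `exists_envelope` over `F` ⟹ ★ p857966 `exists_forall_tsum_indicator_norm_mul_le_linear` (the
  decay constant LINEAR in the envelope mass `N₂F k X`) ⟹ summed over `x₀` with the SHELL binder `hshell` (`Σ_{x₀} N₂F k (l₁(x₀ − Y)) ≤ B_F·(‖l₂‖⁻¹)^θ`, RULING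
  «SHELL-BINDER»; its payer is (D2-f) `K2E1CentreLineShellSumU3`, moderate growth ★ p857765): `Σ'_{x₀} Σ'_{η ≠ 0} ‖𝓕_F Φ_{k,X(x₀)}(η l₂⁻¹)‖ ≤ B·(‖l₂‖⁻¹)^θ·(‖l₂‖⁻¹)^(−m∕[F:ℚ])`
  with `B = c_F · C · B_F`.
HONEST LABEL.  Count-neutral helper; proves no printed statement; HC_CM is proved only modulo the 7 printed citations (2 remaining named inputs: hLiu418 =
`stmt-HodgeConjecture-24832`, h413 = `stmt-HodgeConjecture-24833`) until rung 0 closes.  The archimedean triples and the shell sum are NOT discharged here (binders).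

## References
* [MoeglinWaldspurger1995] C. Mœglin, J.-L. Waldspurger, *Spectral decomposition and Eisenstein series* (1995), I.2.10–I.2.12, II.1.7.
* [Garrett2018] P. Garrett, *Modern Analysis of Automorphic Forms by Example* 1 (2018), §2.9, §12.2.
* [CasselsFrohlichANT1967] J. W. S. Cassels, A. Fröhlich (eds.), *Algebraic Number Theory* (1967), Ch. XV (Tate) Lemma 4.2.4, Thm. 4.1.3.
-/

set_option autoImplicit false
set_option linter.dupNamespace false  -- the mandated namespace repeats the summit's segment (`HodgeConjecture.HodgeConjecture`)

noncomputable section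

open MeasureTheory Measure Filter Topology NumberField IsDedekindDomain MulAction Module
open Literature.NumberTheory.Automorphic Literature.NumberTheory.Automorphic.UnitaryGroup
open Summit.HodgeConjecture.HodgeConjecture.Cruxes.H413.K2E1AdelicFourierEnvelope
open Summit.HodgeConjecture.HodgeConjecture.Cruxes.H413.K2E1AdelicFourierDecay
open Summit.HodgeConjecture.HodgeConjecture.Cruxes.H413.K2E1FlatSectionLineRestrictionU3
open Summit.HodgeConjecture.HodgeConjecture.Cruxes.H413.K2E1FlatSectionCentreAverageU3
open Summit.HodgeConjecture.HodgeConjecture.Cruxes.H413.K2E1FlatSectionLineRestrictionArchU3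
open Summit.HodgeConjecture.HodgeConjecture.Cruxes.H413.K2E1EisensteinMinusConstantTermPoissonInputsU3
open NumberField.mixedEmbedding
-- `Classical` is needed to see the Mathlib normed-space instances on `mixedSpace` (note H5 of `AdelicGLnGlue`)
open scoped ENNReal NNReal Classical

namespace Summit.HodgeConjecture.HodgeConjecture.Cruxes.H413.K2E1EisensteinMinusConstantTermDecayInputsU3

variable {F E : Type} [Field F] [NumberField F] [Field E] [NumberField E] [Algebra F E] [Algebra.IsQuadraticExtension F E] {c : E ≃ₐ[F] E} {δ : E}

/-! ## §1 `hdecE`: the E-layer decay of the centre averages -/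

/-- **`hdecE` of ★ `forall_norm_sub_borelConstantTerm_le_three`, from the E-layer (iii″) triple.**  For `k` in a compact `K`, `f` continuous, left-`B_U(F)`-invariant with a locally
uniform Godement majorant and right-invariant under the finite level `U₀` (open), and an archimedean Fourier triple (`AE`, `N₂E`, `hdecArchE`) for the centre averages
`Φ^Z_k`: `∃ C_E ≥ 0, ∀ k ∈ K, ∀ l₁, ‖l₁‖ ≤ 1 → Summable ∧ Σ'_{ξ≠0} ‖𝓕_E Φ^Z_k(ξ l₁⁻¹)‖ ≤ C_E (‖l₁‖⁻¹)^(−m∕[E:ℚ])` (★ tube lemma, ★ FILE B periodicity∕integrability,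
★ `exists_envelope` (E), ★ `exists_forall_tsum_indicator_norm_mul_le_rpow_neg` (E)). [cite: MoeglinWaldspurger1995, II.1.7] [cite: Garrett2018, §2.9] -/
theorem exists_fourierDecay_centreAverage_three (hc : c * c = 1) (hcδ : c δ = -δ) (hδ : δ ≠ 0)
    [MeasurableSpace (AdeleRing (𝓞 F) F)] [BorelSpace (AdeleRing (𝓞 F) F)] [MeasurableSpace (AdeleRing (𝓞 E) E)] [BorelSpace (AdeleRing (𝓞 E) E)]
    [MeasurableSpace (InfiniteAdeleRing E)] [BorelSpace (InfiniteAdeleRing E)] [MeasurableSpace (FiniteAdeleRing (𝓞 E) E)] [BorelSpace (FiniteAdeleRing (𝓞 E) E)]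
    (μF : Measure (AdeleRing (𝓞 F) F)) [μF.IsAddHaarMeasure] (μE : Measure (AdeleRing (𝓞 E) E)) [μE.IsAddHaarMeasure]
    (μE₁ : Measure (InfiniteAdeleRing E)) [μE₁.IsAddHaarMeasure] (μE₂ : Measure (FiniteAdeleRing (𝓞 E) E)) [μE₂.IsAddHaarMeasure]
    {K : Set (quasiSplit F E c 3).Adelic} (hK : IsCompact K)
    {U₀ : Subgroup (GL (Fin 3) (FiniteAdeleRing (𝓞 E) E))} (hU₀o : IsOpen (U₀ : Set (GL (Fin 3) (FiniteAdeleRing (𝓞 E) E))))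
    {f : (quasiSplit F E c 3).Adelic → ℂ} (hfc : Continuous f)
    (hfB : ∀ b ∈ borelU (c : E →+* E) ((StdForm.antidiagonal 3).over E), ∀ x : (quasiSplit F E c 3).Adelic, f ((quasiSplit F E c 3).toAdelic b * x) = f x)
    (hmaj : ∀ y₀ : (quasiSplit F E c 3).Adelic, ∃ V ∈ 𝓝 y₀,
      ∃ u : Quotient (orbitRel ↥(borelU (c : E →+* E) ((StdForm.antidiagonal 3).over E)) ↥(unitaryGroupOfForm (c : E →+* E) ((StdForm.antidiagonal 3).over E))) → ℝ,
        Summable u ∧ ∀ y ∈ V, ∀ q, ‖f ((quasiSplit F E c 3).toAdelic (q.out : ↥(unitaryGroupOfForm (c : E →+* E) ((StdForm.antidiagonal 3).over E))) * y)‖ ≤ u q)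
    (hfU : ∀ u : (quasiSplit F E c 3).Adelic, adelicVal F E c 3 ((StdForm.antidiagonal 3).over E) u ∈ U₀.map (GLn.ofFinite 3 E) → ∀ y : (quasiSplit F E c 3).Adelic, f (y * u) = f y)
    {m : ℕ} (hm : (finrank ℚ E : ℝ) < m)
    {AE : (quasiSplit F E c 3).Adelic → FiniteAdeleRing (𝓞 E) E → ℝ} {N₂E : ℝ} (hN₂E : 0 ≤ N₂E)
    (hAE : ∀ k ∈ K, Integrable (AE k) μE₂ ∧ ∫ B, AE k B ∂μE₂ ≤ N₂E)
    (hdecArchE : ∀ k ∈ K, ∀ (B : FiniteAdeleRing (𝓞 E) E) (Y : InfiniteAdeleRing E),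
      ‖∫ a, (((μF (adeleFundamentalDomain F)).toReal⁻¹ : ℂ) * ∫ t, f (((quasiSplit F E c 3).toAdelic (weylLongU (c : E →+* E) (rfl : ((StdForm.antidiagonal 3).over E) = ((StdForm.antidiagonal 3).over E)))) * ((heisChart hc ((((a, B)) : AdeleRing (𝓞 E) E), traceZeroLine F E c hcδ hδ t) : ↥(adelicUnipotent F E c 3)) : (quasiSplit F E c 3).Adelic) * k) ∂μF) *
        (adeleAddChar E (infiniteAdeleInl E (Y * a)) : ℂ) ∂μE₁‖ ≤ AE k B * (1 + ‖InfiniteAdeleRing.ringEquiv_mixedSpace E Y‖) ^ (-(m : ℝ))) :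
    ∃ CE : ℝ, 0 ≤ CE ∧ ∀ k ∈ K, ∀ l₁ : (AdeleRing (𝓞 E) E)ˣ, ((IdeleClassGroup.ideleNorm E l₁ : ℝ≥0) : ℝ) ≤ 1 →
      (Summable fun ξ : E =>
        ‖∫ V, (((μF (adeleFundamentalDomain F)).toReal⁻¹ : ℂ) * ∫ s, f (((quasiSplit F E c 3).toAdelic (weylLongU (c : E →+* E) (rfl : ((StdForm.antidiagonal 3).over E) = ((StdForm.antidiagonal 3).over E)))) * ((heisChart hc (V, traceZeroLine F E c hcδ hδ s) : ↥(adelicUnipotent F E c 3)) : (quasiSplit F E c 3).Adelic) * k) ∂μF) * (adeleAddChar E (algebraMap E (AdeleRing (𝓞 E) E) ξ * ((l₁⁻¹ : (AdeleRing (𝓞 E) E)ˣ) : AdeleRing (𝓞 E) E) * V) : ℂ) ∂μE‖) ∧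
      ∑' ξ : E, ({0}ᶜ : Set E).indicator (fun ξ =>
          ‖∫ V, (((μF (adeleFundamentalDomain F)).toReal⁻¹ : ℂ) * ∫ s, f (((quasiSplit F E c 3).toAdelic (weylLongU (c : E →+* E) (rfl : ((StdForm.antidiagonal 3).over E) = ((StdForm.antidiagonal 3).over E)))) * ((heisChart hc (V, traceZeroLine F E c hcδ hδ s) : ↥(adelicUnipotent F E c 3)) : (quasiSplit F E c 3).Adelic) * k) ∂μF) * (adeleAddChar E (algebraMap E (AdeleRing (𝓞 E) E) ξ * ((l₁⁻¹ : (AdeleRing (𝓞 E) E)ˣ) : AdeleRing (𝓞 E) E) * V) : ℂ) ∂μE‖) ξ ≤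
        CE * (((IdeleClassGroup.ideleNorm E l₁ : ℝ≥0) : ℝ)⁻¹) ^ (-((m : ℝ) / (finrank ℚ E : ℝ))) := by
  -- the level subgroup of `f` in `G(𝔸)` and ONE level ideal `𝔪` of `E` for all of `K` (★ PART II tube lemma)
  set U : Subgroup (quasiSplit F E c 3).Adelic := (U₀.map (GLn.ofFinite 3 E)).comap (adelicVal F E c 3 ((StdForm.antidiagonal 3).over E)) with hUdef
  have hfU' : ∀ v ∈ U, ∀ y : (quasiSplit F E c 3).Adelic, f (y * v) = f y := fun v hv y => hfU v (Subgroup.mem_comap.1 hv) y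
  obtain ⟨𝔫, -, 𝔪, h𝔪, htube⟩ := exists_levelIdeal_forall_adelicVal_conj_heisChart_mem_three hc hcδ hδ hK hU₀o
  have hθ0 : traceZeroLine F E c hcδ hδ ((((0 : InfiniteAdeleRing F), (0 : FiniteAdeleRing (𝓞 F) F)) : AdeleRing (𝓞 F) F)) = 0 := map_zero _
  -- `Φ^Z_k` is `𝔪`-periodic in the finite coordinate (★ FILE B)
  have hper : ∀ k ∈ K, ∀ (a : InfiniteAdeleRing E) (B Lf : FiniteAdeleRing (𝓞 E) E), Lf ∈ levelIdeal E 𝔪 →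
      (((μF (adeleFundamentalDomain F)).toReal⁻¹ : ℂ) * ∫ t, f (((quasiSplit F E c 3).toAdelic (weylLongU (c : E →+* E) (rfl : ((StdForm.antidiagonal 3).over E) = ((StdForm.antidiagonal 3).over E)))) * ((heisChart hc ((((a, B + Lf)) : AdeleRing (𝓞 E) E), traceZeroLine F E c hcδ hδ t) : ↥(adelicUnipotent F E c 3)) : (quasiSplit F E c 3).Adelic) * k) ∂μF) =
        (((μF (adeleFundamentalDomain F)).toReal⁻¹ : ℂ) * ∫ t, f (((quasiSplit F E c 3).toAdelic (weylLongU (c : E →+* E) (rfl : ((StdForm.antidiagonal 3).over E) = ((StdForm.antidiagonal 3).over E)))) * ((heisChart hc ((((a, B)) : AdeleRing (𝓞 E) E), traceZeroLine F E c hcδ hδ t) : ↥(adelicUnipotent F E c 3)) : (quasiSplit F E c 3).Adelic) * k) ∂μF) := by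
    intro k hk a B Lf hLf
    have hkU : k⁻¹ * ((heisChart hc ((((0 : InfiniteAdeleRing E), Lf) : AdeleRing (𝓞 E) E), (0 : traceZeroAdele F E c)) : ↥(adelicUnipotent F E c 3)) : (quasiSplit F E c 3).Adelic) * k ∈ U := by
      have h' := htube k hk 0 (levelIdeal F 𝔫).zero_mem Lf hLf
      rw [hθ0] at h'
      exact Subgroup.mem_comap.2 h'
    have hpair : (((a, B + Lf)) : AdeleRing (𝓞 E) E) = ((a, B) : AdeleRing (𝓞 E) E) + (((0 : InfiniteAdeleRing E), Lf) : AdeleRing (𝓞 E) E) :=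
      Prod.ext (add_zero a).symm rfl
    rw [hpair]
    exact congrArg (fun w : ℂ => ((μF (adeleFundamentalDomain F)).toReal⁻¹ : ℂ) * w) (integral_weylLongU_mul_heisChart_add_eq hc hcδ hδ μF hfU' hkU _)
  -- the envelope constants over `E` (★ (F1)) and the decay constant (★ (E2))
  obtain ⟨cE, hcE, Cf, hCfc, henv⟩ := exists_envelope E μE μE₁ μE₂ h𝔪
  have hM0 : 0 ≤ cE * N₂E := mul_nonneg hcE.le hN₂E
  have hmm : (m : ℝ) ≤ ((m : ℕ) : ℝ) := le_rfl
  obtain ⟨C, hC0, hdecay⟩ := exists_forall_tsum_indicator_norm_mul_le_rpow_neg E hM0 hCfc hm hmm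
  refine ⟨C, hC0, fun k hk l₁ _ => ?_⟩
  set Φ : AdeleRing (𝓞 E) E → ℂ := fun V => (((μF (adeleFundamentalDomain F)).toReal⁻¹ : ℂ) * ∫ s, f (((quasiSplit F E c 3).toAdelic (weylLongU (c : E →+* E) (rfl : ((StdForm.antidiagonal 3).over E) = ((StdForm.antidiagonal 3).over E)))) * ((heisChart hc (V, traceZeroLine F E c hcδ hδ s) : ↥(adelicUnipotent F E c 3)) : (quasiSplit F E c 3).Adelic) * k) ∂μF) with hΦ
  have hΦprod : Integrable (fun p : InfiniteAdeleRing E × FiniteAdeleRing (𝓞 E) E => Φ (p.1, p.2)) (μE₁.prod μE₂) :=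
    (integrable_iff_integrable_prod E μE μE₁ μE₂ Φ).1 (integrable_centreAverage_three hc hcδ hδ μF μE hfc hfB hmaj k)
  obtain ⟨hAk, hAN⟩ := hAE k hk
  obtain ⟨hMΨ, hCfΨ⟩ := henv Φ (AE k) N₂E m hΦprod (fun a B Lf hLf => hper k hk a B Lf hLf) (fun B Y => hdecArchE k hk B Y) hAk hAN
  have h := hdecay (fun η => ∫ V, Φ V * (adeleAddChar E (η * V) : ℂ) ∂μE) hMΨ hCfΨ l₁⁻¹
  rw [map_inv, NNReal.coe_inv] at h
  exact h

/-! ## §2 `hdecF`: the F-layer decay of the centre lines, summed over the `x₀`-shell -/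

/-- **`hdecF` of ★ `forall_norm_sub_borelConstantTerm_le_three`, from the F-layer (iii″) triple (per centre `X`) and the shell binder `hshell`** (RULING «SHELL-BINDER»):
`∃ B ≥ 0, ∀ k ∈ K, ∀ l₁ l₂ Y, ‖l₂‖ ≤ 1 → ‖l₁‖ = ‖l₂‖ → (∀ x₀, Summable) ∧ Summable (x₀ ↦ Σ'_{η≠0}) ∧ Σ'_{x₀} Σ'_{η≠0} ‖𝓕_F Φ_{k,l₁(x₀−Y)}(η l₂⁻¹)‖ ≤ B (‖l₂‖⁻¹)^θ (‖l₂‖⁻¹)^(−m∕[F:ℚ])`,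
`B = c_F · C · B_F` (★ tube lemma, ★ FILE A periodicity∕integrability, ★ `exists_envelope` (F), ★ p857966 `exists_forall_tsum_indicator_norm_mul_le_linear` (F), then the shell
sum `hshell`). [cite: MoeglinWaldspurger1995, II.1.7] [cite: Garrett2018, §2.9] -/
theorem exists_fourierDecay_centreLine_shell_three (hc : c * c = 1) (hcδ : c δ = -δ) (hδ : δ ≠ 0)
    [MeasurableSpace (AdeleRing (𝓞 F) F)] [BorelSpace (AdeleRing (𝓞 F) F)]
    [MeasurableSpace (InfiniteAdeleRing F)] [BorelSpace (InfiniteAdeleRing F)] [MeasurableSpace (FiniteAdeleRing (𝓞 F) F)] [BorelSpace (FiniteAdeleRing (𝓞 F) F)]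
    (μF : Measure (AdeleRing (𝓞 F) F)) [μF.IsAddHaarMeasure]
    (μF₁ : Measure (InfiniteAdeleRing F)) [μF₁.IsAddHaarMeasure] (μF₂ : Measure (FiniteAdeleRing (𝓞 F) F)) [μF₂.IsAddHaarMeasure]
    {K : Set (quasiSplit F E c 3).Adelic} (hK : IsCompact K)
    {U₀ : Subgroup (GL (Fin 3) (FiniteAdeleRing (𝓞 E) E))} (hU₀o : IsOpen (U₀ : Set (GL (Fin 3) (FiniteAdeleRing (𝓞 E) E))))
    {f : (quasiSplit F E c 3).Adelic → ℂ} (hfc : Continuous f)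
    (hfB : ∀ b ∈ borelU (c : E →+* E) ((StdForm.antidiagonal 3).over E), ∀ x : (quasiSplit F E c 3).Adelic, f ((quasiSplit F E c 3).toAdelic b * x) = f x)
    (hmaj : ∀ y₀ : (quasiSplit F E c 3).Adelic, ∃ V ∈ 𝓝 y₀,
      ∃ u : Quotient (orbitRel ↥(borelU (c : E →+* E) ((StdForm.antidiagonal 3).over E)) ↥(unitaryGroupOfForm (c : E →+* E) ((StdForm.antidiagonal 3).over E))) → ℝ,
        Summable u ∧ ∀ y ∈ V, ∀ q, ‖f ((quasiSplit F E c 3).toAdelic (q.out : ↥(unitaryGroupOfForm (c : E →+* E) ((StdForm.antidiagonal 3).over E))) * y)‖ ≤ u q)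
    (hfU : ∀ u : (quasiSplit F E c 3).Adelic, adelicVal F E c 3 ((StdForm.antidiagonal 3).over E) u ∈ U₀.map (GLn.ofFinite 3 E) → ∀ y : (quasiSplit F E c 3).Adelic, f (y * u) = f y)
    {m : ℕ} (hm : (finrank ℚ F : ℝ) < m)
    {AF : (quasiSplit F E c 3).Adelic → AdeleRing (𝓞 E) E → FiniteAdeleRing (𝓞 F) F → ℝ} {N₂F : (quasiSplit F E c 3).Adelic → AdeleRing (𝓞 E) E → ℝ} (hN₂F0 : ∀ k ∈ K, ∀ X : AdeleRing (𝓞 E) E, 0 ≤ N₂F k X)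
    (hAF : ∀ k ∈ K, ∀ X : AdeleRing (𝓞 E) E, Integrable (AF k X) μF₂ ∧ ∫ b, AF k X b ∂μF₂ ≤ N₂F k X)
    (hdecArchF : ∀ k ∈ K, ∀ (X : AdeleRing (𝓞 E) E) (b : FiniteAdeleRing (𝓞 F) F) (y : InfiniteAdeleRing F),
      ‖∫ a, f (((quasiSplit F E c 3).toAdelic (weylLongU (c : E →+* E) (rfl : ((StdForm.antidiagonal 3).over E) = ((StdForm.antidiagonal 3).over E)))) * ((heisChart hc (X, traceZeroLine F E c hcδ hδ (((a, b)) : AdeleRing (𝓞 F) F)) : ↥(adelicUnipotent F E c 3)) : (quasiSplit F E c 3).Adelic) * k) *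
        (adeleAddChar F (infiniteAdeleInl F (y * a)) : ℂ) ∂μF₁‖ ≤ AF k X b * (1 + ‖InfiniteAdeleRing.ringEquiv_mixedSpace F y‖) ^ (-(m : ℝ)))
    {BF θ : ℝ} (hBF : 0 ≤ BF)
    (hshell : ∀ k ∈ K, ∀ (l₁ : (AdeleRing (𝓞 E) E)ˣ) (l₂ : (AdeleRing (𝓞 F) F)ˣ) (Y : AdeleRing (𝓞 E) E), ((IdeleClassGroup.ideleNorm F l₂ : ℝ≥0) : ℝ) ≤ 1 → ((IdeleClassGroup.ideleNorm E l₁ : ℝ≥0) : ℝ) = ((IdeleClassGroup.ideleNorm F l₂ : ℝ≥0) : ℝ) →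
      (Summable fun x₀ : E => N₂F k ((l₁ : AdeleRing (𝓞 E) E) * (algebraMap E (AdeleRing (𝓞 E) E) x₀ - Y))) ∧
      ∑' x₀ : E, N₂F k ((l₁ : AdeleRing (𝓞 E) E) * (algebraMap E (AdeleRing (𝓞 E) E) x₀ - Y)) ≤ BF * (((IdeleClassGroup.ideleNorm F l₂ : ℝ≥0) : ℝ)⁻¹) ^ θ) :
    ∃ B : ℝ, 0 ≤ B ∧ ∀ k ∈ K, ∀ (l₁ : (AdeleRing (𝓞 E) E)ˣ) (l₂ : (AdeleRing (𝓞 F) F)ˣ) (Y : AdeleRing (𝓞 E) E), ((IdeleClassGroup.ideleNorm F l₂ : ℝ≥0) : ℝ) ≤ 1 →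
      ((IdeleClassGroup.ideleNorm E l₁ : ℝ≥0) : ℝ) = ((IdeleClassGroup.ideleNorm F l₂ : ℝ≥0) : ℝ) →
      (∀ x₀ : E, Summable fun η : F =>
        ‖∫ v, f (((quasiSplit F E c 3).toAdelic (weylLongU (c : E →+* E) (rfl : ((StdForm.antidiagonal 3).over E) = ((StdForm.antidiagonal 3).over E)))) * ((heisChart hc (((l₁ : AdeleRing (𝓞 E) E) * (algebraMap E (AdeleRing (𝓞 E) E) x₀ - Y)), traceZeroLine F E c hcδ hδ v) : ↥(adelicUnipotent F E c 3)) : (quasiSplit F E c 3).Adelic) * k) * (adeleAddChar F (algebraMap F (AdeleRing (𝓞 F) F) η * ((l₂⁻¹ : (AdeleRing (𝓞 F) F)ˣ) : AdeleRing (𝓞 F) F) * v) : ℂ) ∂μF‖) ∧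
      (Summable fun x₀ : E => ∑' η : F, ({0}ᶜ : Set F).indicator (fun η =>
        ‖∫ v, f (((quasiSplit F E c 3).toAdelic (weylLongU (c : E →+* E) (rfl : ((StdForm.antidiagonal 3).over E) = ((StdForm.antidiagonal 3).over E)))) * ((heisChart hc (((l₁ : AdeleRing (𝓞 E) E) * (algebraMap E (AdeleRing (𝓞 E) E) x₀ - Y)), traceZeroLine F E c hcδ hδ v) : ↥(adelicUnipotent F E c 3)) : (quasiSplit F E c 3).Adelic) * k) * (adeleAddChar F (algebraMap F (AdeleRing (𝓞 F) F) η * ((l₂⁻¹ : (AdeleRing (𝓞 F) F)ˣ) : AdeleRing (𝓞 F) F) * v) : ℂ) ∂μF‖) η) ∧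
      ∑' x₀ : E, ∑' η : F, ({0}ᶜ : Set F).indicator (fun η =>
          ‖∫ v, f (((quasiSplit F E c 3).toAdelic (weylLongU (c : E →+* E) (rfl : ((StdForm.antidiagonal 3).over E) = ((StdForm.antidiagonal 3).over E)))) * ((heisChart hc (((l₁ : AdeleRing (𝓞 E) E) * (algebraMap E (AdeleRing (𝓞 E) E) x₀ - Y)), traceZeroLine F E c hcδ hδ v) : ↥(adelicUnipotent F E c 3)) : (quasiSplit F E c 3).Adelic) * k) * (adeleAddChar F (algebraMap F (AdeleRing (𝓞 F) F) η * ((l₂⁻¹ : (AdeleRing (𝓞 F) F)ˣ) : AdeleRing (𝓞 F) F) * v) : ℂ) ∂μF‖) η ≤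
        B * (((IdeleClassGroup.ideleNorm F l₂ : ℝ≥0) : ℝ)⁻¹) ^ θ * (((IdeleClassGroup.ideleNorm F l₂ : ℝ≥0) : ℝ)⁻¹) ^ (-((m : ℝ) / (finrank ℚ F : ℝ))) := by
  -- the level subgroup of `f` and ONE level ideal `𝔫` of `F` for all of `K` (★ PART II tube lemma)
  set U : Subgroup (quasiSplit F E c 3).Adelic := (U₀.map (GLn.ofFinite 3 E)).comap (adelicVal F E c 3 ((StdForm.antidiagonal 3).over E)) with hUdef
  have hfU' : ∀ v ∈ U, ∀ y : (quasiSplit F E c 3).Adelic, f (y * v) = f y := fun v hv y => hfU v (Subgroup.mem_comap.1 hv) y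
  obtain ⟨𝔫, h𝔫, 𝔪, -, htube⟩ := exists_levelIdeal_forall_adelicVal_conj_heisChart_mem_three hc hcδ hδ hK hU₀o
  have h0E : ((((0 : InfiniteAdeleRing E), (0 : FiniteAdeleRing (𝓞 E) E)) : AdeleRing (𝓞 E) E)) = 0 := Prod.mk_zero_zero
  -- the centre lines are `𝔫`-periodic in the finite coordinate (★ FILE A), for every centre `X`
  have hper : ∀ k ∈ K, ∀ (X : AdeleRing (𝓞 E) E) (a : InfiniteAdeleRing F) (b l : FiniteAdeleRing (𝓞 F) F), l ∈ levelIdeal F 𝔫 →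
      f (((quasiSplit F E c 3).toAdelic (weylLongU (c : E →+* E) (rfl : ((StdForm.antidiagonal 3).over E) = ((StdForm.antidiagonal 3).over E)))) * ((heisChart hc (X, traceZeroLine F E c hcδ hδ (((a, b + l)) : AdeleRing (𝓞 F) F)) : ↥(adelicUnipotent F E c 3)) : (quasiSplit F E c 3).Adelic) * k) =
        f (((quasiSplit F E c 3).toAdelic (weylLongU (c : E →+* E) (rfl : ((StdForm.antidiagonal 3).over E) = ((StdForm.antidiagonal 3).over E)))) * ((heisChart hc (X, traceZeroLine F E c hcδ hδ (((a, b)) : AdeleRing (𝓞 F) F)) : ↥(adelicUnipotent F E c 3)) : (quasiSplit F E c 3).Adelic) * k) := by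
    intro k hk X a b l hl
    have hkU : k⁻¹ * ((heisChart hc ((0 : AdeleRing (𝓞 E) E), traceZeroLine F E c hcδ hδ ((((0 : InfiniteAdeleRing F), l)) : AdeleRing (𝓞 F) F)) : ↥(adelicUnipotent F E c 3)) : (quasiSplit F E c 3).Adelic) * k ∈ U := by
      have h' := htube k hk l hl 0 (levelIdeal E 𝔪).zero_mem
      rw [h0E] at h'
      exact Subgroup.mem_comap.2 h'
    have hpair : (((a, b + l)) : AdeleRing (𝓞 F) F) = ((a, b) : AdeleRing (𝓞 F) F) + (((0 : InfiniteAdeleRing F), l) : AdeleRing (𝓞 F) F) :=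
      Prod.ext (add_zero a).symm rfl
    rw [hpair]
    exact apply_weylLongU_mul_heisChart_add_eq hc hcδ hδ hfU' hkU X _
  -- the envelope constants over `F` (★ (F1)) and the LINEAR decay constant (★ p857966 §4)
  obtain ⟨cF, hcF, Cf, hCfc, henv⟩ := exists_envelope F μF μF₁ μF₂ h𝔫
  have hmm : (m : ℝ) ≤ ((m : ℕ) : ℝ) := le_rfl
  obtain ⟨C, hC0, hlin⟩ := exists_forall_tsum_indicator_norm_mul_le_linear F hCfc hm hmm
  refine ⟨cF * C * BF, mul_nonneg (mul_nonneg hcF.le hC0) hBF, fun k hk l₁ l₂ Y hl₂ hl => ?_⟩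
  -- per centre `X`: summability and the bound `c_F · N₂F k X · C · (‖l₂‖⁻¹)^(−m∕[F:ℚ])`
  have hX : ∀ X : AdeleRing (𝓞 E) E,
      (Summable fun η : F => ‖∫ v, f (((quasiSplit F E c 3).toAdelic (weylLongU (c : E →+* E) (rfl : ((StdForm.antidiagonal 3).over E) = ((StdForm.antidiagonal 3).over E)))) * ((heisChart hc (X, traceZeroLine F E c hcδ hδ v) : ↥(adelicUnipotent F E c 3)) : (quasiSplit F E c 3).Adelic) * k) * (adeleAddChar F (algebraMap F (AdeleRing (𝓞 F) F) η * ((l₂⁻¹ : (AdeleRing (𝓞 F) F)ˣ) : AdeleRing (𝓞 F) F) * v) : ℂ) ∂μF‖) ∧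
      ∑' η : F, ({0}ᶜ : Set F).indicator (fun η => ‖∫ v, f (((quasiSplit F E c 3).toAdelic (weylLongU (c : E →+* E) (rfl : ((StdForm.antidiagonal 3).over E) = ((StdForm.antidiagonal 3).over E)))) * ((heisChart hc (X, traceZeroLine F E c hcδ hδ v) : ↥(adelicUnipotent F E c 3)) : (quasiSplit F E c 3).Adelic) * k) * (adeleAddChar F (algebraMap F (AdeleRing (𝓞 F) F) η * ((l₂⁻¹ : (AdeleRing (𝓞 F) F)ˣ) : AdeleRing (𝓞 F) F) * v) : ℂ) ∂μF‖) η ≤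
        cF * N₂F k X * C * (((IdeleClassGroup.ideleNorm F l₂ : ℝ≥0) : ℝ)⁻¹) ^ (-((m : ℝ) / (finrank ℚ F : ℝ))) := by
    intro X
    set Φ : AdeleRing (𝓞 F) F → ℂ := fun v => f (((quasiSplit F E c 3).toAdelic (weylLongU (c : E →+* E) (rfl : ((StdForm.antidiagonal 3).over E) = ((StdForm.antidiagonal 3).over E)))) * ((heisChart hc (X, traceZeroLine F E c hcδ hδ v) : ↥(adelicUnipotent F E c 3)) : (quasiSplit F E c 3).Adelic) * k) with hΦ
    have hΦprod : Integrable (fun p : InfiniteAdeleRing F × FiniteAdeleRing (𝓞 F) F => Φ (p.1, p.2)) (μF₁.prod μF₂) :=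
      (integrable_iff_integrable_prod F μF μF₁ μF₂ Φ).1 (integrable_centreLine_three hc hcδ hδ μF hfc hfB hmaj X k)
    obtain ⟨hAk, hAN⟩ := hAF k hk X
    obtain ⟨hMΨ, hCfΨ⟩ := henv Φ (AF k X) (N₂F k X) m hΦprod (fun a b l hl => hper k hk X a b l hl) (fun b y => hdecArchF k hk X b y) hAk hAN
    have h := hlin (cF * N₂F k X) (mul_nonneg hcF.le (hN₂F0 k hk X)) (fun η => ∫ v, Φ v * (adeleAddChar F (η * v) : ℂ) ∂μF) hMΨ hCfΨ l₂⁻¹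
    rw [map_inv, NNReal.coe_inv] at h
    exact h
  -- the shell sum
  obtain ⟨hNs, hNle⟩ := hshell k hk l₁ l₂ Y hl₂ hl
  have hr : 0 ≤ (((IdeleClassGroup.ideleNorm F l₂ : ℝ≥0) : ℝ)⁻¹) ^ (-((m : ℝ) / (finrank ℚ F : ℝ))) := Real.rpow_nonneg (inv_nonneg.2 (NNReal.coe_nonneg _)) _
  have hS : Summable fun x₀ : E => ∑' η : F, ({0}ᶜ : Set F).indicator (fun η =>
      ‖∫ v, f (((quasiSplit F E c 3).toAdelic (weylLongU (c : E →+* E) (rfl : ((StdForm.antidiagonal 3).over E) = ((StdForm.antidiagonal 3).over E)))) * ((heisChart hc (((l₁ : AdeleRing (𝓞 E) E) * (algebraMap E (AdeleRing (𝓞 E) E) x₀ - Y)), traceZeroLine F E c hcδ hδ v) : ↥(adelicUnipotent F E c 3)) : (quasiSplit F E c 3).Adelic) * k) * (adeleAddChar F (algebraMap F (AdeleRing (𝓞 F) F) η * ((l₂⁻¹ : (AdeleRing (𝓞 F) F)ˣ) : AdeleRing (𝓞 F) F) * v) : ℂ) ∂μF‖) η := by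
    refine Summable.of_nonneg_of_le (fun x₀ => tsum_nonneg fun η => Set.indicator_nonneg (fun _ _ => norm_nonneg _) η) (fun x₀ => (hX _).2) ?_
    exact ((hNs.mul_left cF).mul_right C).mul_right _
  refine ⟨fun x₀ => (hX _).1, hS, ?_⟩
  calc ∑' x₀ : E, ∑' η : F, ({0}ᶜ : Set F).indicator (fun η => ‖∫ v, f (((quasiSplit F E c 3).toAdelic (weylLongU (c : E →+* E) (rfl : ((StdForm.antidiagonal 3).over E) = ((StdForm.antidiagonal 3).over E)))) * ((heisChart hc (((l₁ : AdeleRing (𝓞 E) E) * (algebraMap E (AdeleRing (𝓞 E) E) x₀ - Y)), traceZeroLine F E c hcδ hδ v) : ↥(adelicUnipotent F E c 3)) : (quasiSplit F E c 3).Adelic) * k) * (adeleAddChar F (algebraMap F (AdeleRing (𝓞 F) F) η * ((l₂⁻¹ : (AdeleRing (𝓞 F) F)ˣ) : AdeleRing (𝓞 F) F) * v) : ℂ) ∂μF‖) η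
      ≤ ∑' x₀ : E, cF * N₂F k ((l₁ : AdeleRing (𝓞 E) E) * (algebraMap E (AdeleRing (𝓞 E) E) x₀ - Y)) * C * (((IdeleClassGroup.ideleNorm F l₂ : ℝ≥0) : ℝ)⁻¹) ^ (-((m : ℝ) / (finrank ℚ F : ℝ))) :=
        Summable.tsum_le_tsum (fun x₀ => (hX _).2) hS (((hNs.mul_left cF).mul_right C).mul_right _)
    _ = cF * C * (((IdeleClassGroup.ideleNorm F l₂ : ℝ≥0) : ℝ)⁻¹) ^ (-((m : ℝ) / (finrank ℚ F : ℝ))) * ∑' x₀ : E, N₂F k ((l₁ : AdeleRing (𝓞 E) E) * (algebraMap E (AdeleRing (𝓞 E) E) x₀ - Y)) := by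
        rw [← tsum_mul_left]; exact tsum_congr fun x₀ => by ring
    _ ≤ cF * C * (((IdeleClassGroup.ideleNorm F l₂ : ℝ≥0) : ℝ)⁻¹) ^ (-((m : ℝ) / (finrank ℚ F : ℝ))) * (BF * (((IdeleClassGroup.ideleNorm F l₂ : ℝ≥0) : ℝ)⁻¹) ^ θ) :=
        mul_le_mul_of_nonneg_left hNle (mul_nonneg (mul_nonneg hcF.le hC0) hr)
    _ = cF * C * BF * (((IdeleClassGroup.ideleNorm F l₂ : ℝ≥0) : ℝ)⁻¹) ^ θ * (((IdeleClassGroup.ideleNorm F l₂ : ℝ≥0) : ℝ)⁻¹) ^ (-((m : ℝ) / (finrank ℚ F : ℝ))) := by ring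

end Summit.HodgeConjecture.HodgeConjecture.Cruxes.H413.K2E1EisensteinMinusConstantTermDecayInputsU3

end
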